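import Mathlib
import Literature.NumberTheory.LFunctions.Zhang2022.Section12Eq126Pieces
import Literature.NumberTheory.LFunctions.Zhang2022.Section12SjWindowBound
import Literature.NumberTheory.LFunctions.Zhang2022.Section4Prop22Eventually
import Literature.NumberTheory.LFunctions.Zhang2022.Section7Prop71Holds
import HarnessLib

/-!
# Zhang (2022) §12 (12.6) p. 67: `hS` — the window estimate `S_j(𝐛,𝐛̄) = o(α𝔞)` — and (12.6) ITSELF

Topic `Literature/NumberTheory/LFunctions/Zhang2022` (Landau–Siegel audit tree; verdict-neutral).
Y. Zhang, *Discrete mean estimates and the Landau–Siegel zero*, arXiv:2211.02515v1 (2022)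
[Zhang2022LandauSiegel] — **an unrefereed manuscript under adjudication; nothing in this file
asserts or denies its Theorems 1–2.** What this is: kernel theorems about typed-as-printed displays
of the manuscript (the binder `h126 : Typed.Sec12A.Eq126 c′` of `Skeleton.theorem1_of_leaves_v2x`,
the (12.6) half of the leaf hXi = `Typed.Sec12A.Xi15Hbar16` under RT-06; cell GAP row G-d42-2) and
the (8.25)/(8.26)-type window estimate they need (v1 writes «≪» at §12 p. 67, tex L3404–L3415, and
cites displays (8.25)/(8.26) that do not exist; the manuscript's own steps u004–u008 are not used).
No statement about Landau–Siegel zeros is made or implied.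

## Content (WP11-PLAN v2 §8; signatures = the planner's kernel-elaborated SketchHS.lean, verbatim)

* `Sj_b126In_small` — the (in,in) CORE: `‖S_j(𝐛_in,𝐛̄_in)‖ ≤ ε·α·𝔞` eventually under (A), by the
  tree's S_j-level coupled-window engine `XiZeroMajorant.norm_Sj_window_le` (p481790, zl-w11-p5:
  engine p478767 + true-size majorant p479797 + weights p480907) at `Y = Y′ = e^{𝓛⁹/2−𝓛⁻¹⁴}`,
  `1+δ = e^{2𝓛⁻¹⁴}`, `B = 0.005` (`norm_b126In_le_window`; RHS `≤ 321𝓛⁻¹³`, `engine_rhs_inner_le`):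
  margin `𝓛⁴` against `α𝔞 ≥ πa₀𝓛⁻⁹`;
* `Sj_h15_window_small` — **`hS` LITERALLY** (the hypothesis of `Typed.Sec12A.eq126_of_sj_small`),
  `:= Sj_h15_window_small_of_inner c' (Sj_b126In_small c')` (pieces file p483242: the eight non-core
  pairs by the window bound p477114 and the true-size bound p477106);
* `eq126_of_inputs (c') (h22 : Prop22i) (h23 : Lemma23 c') (h81 : Lemma81 c') (h71 : Prop71 c') :
  Eq126 c'` — the pointwise plug for the skeleton binder;
* `eq126_holds : ∃ c₀, 0 ≤ c₀ ∧ ∀ c' ≥ c₀, Eq126 c'` — **(12.6) HOLDS for all large `c′`**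
  (`prop22i_holds`, `lemma23_eventually`, `lemma81_eventually`, `prop71X_holds`).

Theorems only, 0 definitions; standard axioms.

## References

* Y. Zhang, arXiv:2211.02515v1 (2022), §12 (12.6) p. 66–67 (tex L3386–L3415); §7 Prop. 7.1;
  §8 Lemma 8.1; §11 p. 64. [cite: Zhang2022LandauSiegel, §12 (12.6) p.67]
-/

noncomputable section

open Complex Real ComplexConjugate

namespace Literature.NumberTheory.LFunctions.Zhang2022.Typed.Sec12A

open Skeleton

/-! ### Elementary helpers -/

/-- From `⌈exp K⌉ ≤ D`: `K ≤ log D = 𝓛`. [folklore] -/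
private theorem le_ell_of_ceil_exp_le_core {K : ℝ} {D : ℕ} (hD : ⌈Real.exp K⌉₊ ≤ D) :
    K ≤ ell D := by
  have hexp : Real.exp K ≤ D := le_trans (Nat.le_ceil _) (by exact_mod_cast hD)
  rw [ell]
  exact (Real.le_log_iff_exp_le (lt_of_lt_of_le (Real.exp_pos _) hexp)).mpr hexp

/-- From `⌈exp K⌉ ≤ D` with `K ≥ 1`: `2 ≤ D`. [folklore] -/
private theorem two_le_of_ceil_exp_le_core {K : ℝ} {D : ℕ} (hK : 1 ≤ K)
    (hD : ⌈Real.exp K⌉₊ ≤ D) : 2 ≤ D := by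
  have hexp : Real.exp K ≤ D := le_trans (Nat.le_ceil _) (by exact_mod_cast hD)
  have h2 : (2 : ℝ) ≤ Real.exp K := by
    have := Real.add_one_le_exp K; linarith
  exact_mod_cast (le_trans h2 hexp)

section Core

variable {D : ℕ} (χ : DirichletCharacter ℂ D)

/-- **Support of the inner piece in the engine's shape**: with `Y := e^{𝓛⁹/2 − 𝓛⁻¹⁴}` and
`1 + δ := e^{2𝓛⁻¹⁴}`, `‖𝐛_in n‖ ≤ 0.005·𝟙[Y < n ≤ Y(1+δ)]` (`D ≥ 2`, `𝓛 ≥ 2`) — the `ha₁/ha₂`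
hypothesis shape of `XiZeroMajorant.norm_Sj_window_le`. [cite: Zhang2022LandauSiegel, §12 (12.6) p.67] -/
theorem norm_b126In_le_window (hD : 2 ≤ D) (hL : 2 ≤ ell D) (n : ℕ) :
    ‖b126In D χ n‖ ≤
      if Real.exp (ell D ^ 9 / 2 - (ell D ^ 14)⁻¹) < (n : ℝ) ∧
          (n : ℝ) ≤ Real.exp (ell D ^ 9 / 2 - (ell D ^ 14)⁻¹) *
            (1 + (Real.exp (2 * (ell D ^ 14)⁻¹) - 1))
        then 0.005 else 0 := by
  by_cases h0 : b126In D χ n = 0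
  · rw [h0, norm_zero]; split_ifs <;> norm_num
  · have hIn : |Real.log n - ell D ^ 9 / 2| < (ell D ^ 14)⁻¹ := by
      by_contra hc; exact h0 (by unfold b126In; rw [if_neg hc])
    have hb : b126 D χ n ≠ 0 := by
      intro hb; exact h0 (by unfold b126In; rw [if_pos hIn, hb])
    have hn := cast_pos_of_b126_ne_zero χ hD hb
    rw [abs_lt] at hIn
    have hwin : Real.exp (ell D ^ 9 / 2 - (ell D ^ 14)⁻¹) < (n : ℝ) ∧
        (n : ℝ) ≤ Real.exp (ell D ^ 9 / 2 - (ell D ^ 14)⁻¹) *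
          (1 + (Real.exp (2 * (ell D ^ 14)⁻¹) - 1)) := by
      constructor
      · calc Real.exp (ell D ^ 9 / 2 - (ell D ^ 14)⁻¹) < Real.exp (Real.log n) :=
            Real.exp_lt_exp.mpr (by linarith [hIn.1])
          _ = n := Real.exp_log hn
      · rw [add_sub_cancel, ← Real.exp_add]
        calc (n : ℝ) = Real.exp (Real.log n) := (Real.exp_log hn).symm
          _ ≤ _ := Real.exp_le_exp.mpr (by linarith [hIn.2])
    rw [if_pos hwin]
    exact norm_b126In_le χ hD hL n

/-- The engine RHS at the inner window is `O(𝓛⁻¹³)`: for `𝓛 ≥ 28`, with `Y = e^{𝓛⁹/2−𝓛⁻¹⁴}`,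
`δ = e^{2𝓛⁻¹⁴} − 1`: `2δ(δ(1+log 2Y)+2) + 4δ(1+log(2/δ)) + 16/√(δY) ≤ 321·𝓛⁻¹³`. [folklore] -/
private theorem engine_rhs_inner_le {ℓ : ℝ} (hℓ : 28 ≤ ℓ) :
    let Y := Real.exp (ℓ ^ 9 / 2 - (ℓ ^ 14)⁻¹)
    let δ := Real.exp (2 * (ℓ ^ 14)⁻¹) - 1
    2 * δ * (δ * (1 + Real.log (2 * Y)) + 2) + 4 * (δ * (1 + Real.log (2 / δ))) +
        16 / Real.sqrt (δ * Y) ≤ 321 * (ℓ ^ 13)⁻¹ := by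
  intro Y δ
  have hℓ1 : 1 ≤ ℓ := by linarith
  have hℓ0 : 0 < ℓ := by linarith
  set w : ℝ := (ℓ ^ 14)⁻¹ with hw
  have hw0 : 0 < w := by rw [hw]; positivity
  have hℓ14 : (28 : ℝ) ≤ ℓ ^ 14 := le_trans hℓ (le_self_pow₀ hℓ1 (by norm_num))
  have hw1 : w ≤ 1 / 28 := by
    rw [hw, inv_eq_one_div]; exact one_div_le_one_div_of_le (by norm_num) hℓ14
  -- δ between 2w and 4w
  have hδlo : 2 * w ≤ δ := by
    have := Real.add_one_le_exp (2 * w); show 2 * w ≤ Real.exp (2 * w) - 1; linarith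
  have hδhi : δ ≤ 4 * w := by
    have h := Real.abs_exp_sub_one_le (x := 2 * w) (by rw [abs_of_pos (by positivity)]; linarith)
    rw [abs_of_pos (by positivity : (0:ℝ) < 2 * w)] at h
    have := le_abs_self (Real.exp (2 * w) - 1)
    show Real.exp (2 * w) - 1 ≤ 4 * w; linarith
  have hδ0 : 0 < δ := lt_of_lt_of_le (by positivity) hδlo
  have hδ1 : δ ≤ 1 := by linarith
  -- log (2Y) ≤ 1 + ℓ⁹/2
  have hY0 : 0 < Y := Real.exp_pos _
  have hlog2Y : Real.log (2 * Y) ≤ 1 + ℓ ^ 9 / 2 := by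
    rw [Real.log_mul (by norm_num) hY0.ne', Real.log_exp]
    have : Real.log 2 ≤ 1 := by
      have := Real.log_le_sub_one_of_pos (by norm_num : (0:ℝ) < 2); linarith
    linarith [hw0]
  have h9 : (1 : ℝ) ≤ ℓ ^ 9 := one_le_pow₀ hℓ1
  -- term 1: 2δ(δ(1+log 2Y)+2) ≤ 80 w
  have hwl9 : w * ℓ ^ 9 ≤ 1 := by
    rw [hw, inv_mul_le_iff₀ (by positivity), mul_one]
    exact pow_le_pow_right₀ hℓ1 (by norm_num)
  have hY1 : 1 ≤ Y := by
    apply Real.one_le_exp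
    rw [← hw]; linarith
  have hlog0 : 0 ≤ Real.log (2 * Y) := Real.log_nonneg (by linarith)
  have hA : δ * (1 + Real.log (2 * Y)) ≤ 8 := by
    calc δ * (1 + Real.log (2 * Y)) ≤ (4 * w) * (2 + ℓ ^ 9 / 2) :=
          mul_le_mul hδhi (by linarith) (by linarith) (by positivity)
      _ = 8 * w + 2 * (w * ℓ ^ 9) := by ring
      _ ≤ 8 * (1 / 28) + 2 * 1 := by gcongr
      _ ≤ 8 := by norm_num
  have hB : 0 ≤ δ * (1 + Real.log (2 * Y)) + 2 :=
    add_nonneg (mul_nonneg hδ0.le (by linarith)) (by norm_num)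
  have t1 : 2 * δ * (δ * (1 + Real.log (2 * Y)) + 2) ≤ 80 * w := by
    calc 2 * δ * (δ * (1 + Real.log (2 * Y)) + 2) ≤ 2 * (4 * w) * (8 + 2) :=
          mul_le_mul (by linarith) (by linarith) hB (by positivity)
      _ = 80 * w := by ring
  -- term 2: 4δ(1+log(2/δ)) ≤ 240 ℓ⁻¹³
  have t2 : 4 * (δ * (1 + Real.log (2 / δ))) ≤ 240 * (ℓ ^ 13)⁻¹ := by
    have hlog : Real.log (2 / δ) ≤ 14 * ℓ := by
      have h2δ : 2 / δ ≤ ℓ ^ 14 := by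
        rw [div_le_iff₀ hδ0]
        calc (2:ℝ) = ℓ ^ 14 * (2 * w) := by rw [hw]; field_simp
          _ ≤ ℓ ^ 14 * δ := by gcongr
      calc Real.log (2 / δ) ≤ Real.log (ℓ ^ 14) := Real.log_le_log (by positivity) h2δ
        _ = 14 * Real.log ℓ := by rw [Real.log_pow]; norm_num
        _ ≤ 14 * ℓ := by
            gcongr
            have := Real.log_le_sub_one_of_pos hℓ0; linarith
    have hlog0 : 0 ≤ Real.log (2 / δ) := Real.log_nonneg (by
      rw [le_div_iff₀ hδ0]; linarith)
    calc 4 * (δ * (1 + Real.log (2 / δ))) ≤ 4 * ((4 * w) * (1 + 14 * ℓ)) := by gcongr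
      _ ≤ 4 * ((4 * w) * (15 * ℓ)) := by gcongr; linarith
      _ = 240 * ((ℓ ^ 14)⁻¹ * ℓ) := by rw [hw]; ring
      _ = 240 * (ℓ ^ 13)⁻¹ := by
          congr 1
          rw [show ℓ ^ 14 = ℓ ^ 13 * ℓ by ring, mul_inv, mul_assoc, inv_mul_cancel₀ hℓ0.ne',
            mul_one]
  -- term 3: 16/√(δY) ≤ ℓ⁻¹³
  have t3 : 16 / Real.sqrt (δ * Y) ≤ (ℓ ^ 13)⁻¹ := by
    -- Y ≥ e^{ℓ⁹/4} ≥ (ℓ⁹/4)^5/120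
    have hYlo : ℓ ^ 45 / 122880 ≤ Y := by
      have h1 : ℓ ^ 9 / 4 ≤ ℓ ^ 9 / 2 - (ℓ ^ 14)⁻¹ := by
        rw [← hw]; nlinarith [h9, hw1]
      have h2 := Real.pow_div_factorial_le_exp (ℓ ^ 9 / 4) (by positivity) 5
      have h5 : ((5 : ℕ).factorial : ℝ) = 120 := by norm_num [Nat.factorial]
      rw [h5] at h2
      calc ℓ ^ 45 / 122880 = (ℓ ^ 9 / 4) ^ 5 / 120 := by ring
        _ ≤ Real.exp (ℓ ^ 9 / 4) := h2
        _ ≤ Y := Real.exp_le_exp.mpr h1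
    have hδY : (16 * ℓ ^ 13) ^ 2 ≤ δ * Y := by
      have hℓ5 : (15728640 : ℝ) ≤ ℓ ^ 5 := by
        calc (15728640 : ℝ) ≤ 28 ^ 5 := by norm_num
          _ ≤ ℓ ^ 5 := by gcongr
      calc (16 * ℓ ^ 13) ^ 2 = 256 * ℓ ^ 26 := by ring
        _ ≤ (2 * (ℓ ^ 14)⁻¹) * (ℓ ^ 45 / 122880) := by
            rw [show (2 * (ℓ ^ 14)⁻¹) * (ℓ ^ 45 / 122880) = ℓ ^ 26 * (ℓ ^ 5 / 61440) by
              field_simp; ring]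
            nlinarith [pow_nonneg hℓ0.le 26]
        _ ≤ δ * Y := by
            rw [← hw]
            exact mul_le_mul hδlo hYlo (by positivity) hδ0.le
    have hsq : 16 * ℓ ^ 13 ≤ Real.sqrt (δ * Y) :=
      (Real.le_sqrt (by positivity) (by positivity)).mpr hδY
    calc 16 / Real.sqrt (δ * Y) ≤ 16 / (16 * ℓ ^ 13) :=
          div_le_div_of_nonneg_left (by norm_num) (by positivity) hsq
      _ = (ℓ ^ 13)⁻¹ := by field_simp
  have hw13 : w ≤ (ℓ ^ 13)⁻¹ := by
    rw [hw]; exact inv_anti₀ (by positivity) (pow_le_pow_right₀ hℓ1 (by norm_num))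
  linarith

/-- **The (in,in) CORE of `hS`**: for every `ε > 0`, eventually under (A),
`‖S_j(𝐛_in,𝐛̄_in)‖ ≤ ε·α·𝔞` (`j = 1,2,3`), where `𝐛_in = 𝐛·𝟙[|log n − 𝓛⁹/2| < 𝓛⁻¹⁴]` is the inner
piece of the (12.6) coefficient sequence (`Typed.Sec12A.b126In`, sup `0.005`). By the tree's
S_j-level coupled-window engine `XiZeroMajorant.norm_Sj_window_le` (p481790; zl-w11-p5) at
`Y = Y′ = e^{𝓛⁹/2−𝓛⁻¹⁴}`, `1+δ = 1+δ′ = e^{2𝓛⁻¹⁴}`, `B₁ = B₂ = 0.005`: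
`‖S_j‖ ≤ 2.5·10⁻⁵·E_w·(2δ(δ(1+log 2Y)+2) + 4δ(1+log(2/δ)) + 16/√(δY)) ≤ 0.01·E_w·𝓛⁻¹³ ≤ ε·(π𝓛⁻⁹)·a₀
≤ ε·α·𝔞` for `𝓛 ≥ 0.01E_w/(επa₀) + 28` (`frakALowerBound_holds`). An absolute-value estimate — no
character cancellation; the manuscript (§12 p. 67, tex L3404–L3415) writes «≪» here and cites the
non-existent (8.25)/(8.26). [cite: Zhang2022LandauSiegel, §12 (12.6) p.67; §11 p.64] -/
theorem Sj_b126In_small (c' : ℝ) :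
    ∀ ε : ℝ, 0 < ε → ForAllLarge fun D _ χ => AssumptionA D χ →
      ∀ j ∈ ({1, 2, 3} : Finset ℕ),
        ‖Sj c' D j (b126In D χ) (fun n : ℕ => conj (b126In D χ n))‖ ≤
          ε * alpha D * frakA χ := by
  intro ε hε
  obtain ⟨a₀, ha₀, hA⟩ := frakALowerBound_holds
  obtain ⟨D₁, h₁⟩ := hA
  have hEw := XiZeroMajorant.Ew_nonneg
  set L : ℝ := 0.01 * XiZeroMajorant.Ew / (ε * π * a₀) + 28 with hL
  have hL28 : 28 ≤ L := by
    have : 0 ≤ 0.01 * XiZeroMajorant.Ew / (ε * π * a₀) := by positivity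
    linarith
  refine ⟨max (max D₁ ⌈Real.exp (5 * |c'| * π + 3)⌉₊) ⌈Real.exp L⌉₊,
    fun D _ χ hD hq hp hAss j hj => ?_⟩
  have hD₁ : D₁ ≤ D := le_trans (le_trans (le_max_left _ _) (le_max_left _ _)) hD
  have hDS : ⌈Real.exp (5 * |c'| * π + 3)⌉₊ ≤ D :=
    le_trans (le_trans (le_max_right _ _) (le_max_left _ _)) hD
  have hDL : ⌈Real.exp L⌉₊ ≤ D := le_trans (le_max_right _ _) hD
  have hℓL : L ≤ ell D := le_ell_of_ceil_exp_le_core hDL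
  have hℓ28 : 28 ≤ ell D := le_trans hL28 hℓL
  have hℓ1 : 1 ≤ ell D := by linarith
  have hℓ2 : 2 ≤ ell D := by linarith
  have hℓ0 : 0 < ell D := by linarith
  have hD2 : 2 ≤ D := two_le_of_ceil_exp_le_core (by linarith) hDL
  have ha : a₀ ≤ frakA χ := h₁ D χ hD₁ hq hp hAss
  have hα : alpha D = π / ell D ^ 9 := by rw [alpha, bigP, Real.log_exp]
  have hα0 : 0 < alpha D := by rw [hα]; positivity
  -- engine parameters
  set Y : ℝ := Real.exp (ell D ^ 9 / 2 - (ell D ^ 14)⁻¹) with hY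
  set δ : ℝ := Real.exp (2 * (ell D ^ 14)⁻¹) - 1 with hδ
  have hw0 : 0 < (ell D ^ 14)⁻¹ := by positivity
  have hw1 : (ell D ^ 14)⁻¹ ≤ 1 / 28 := by
    rw [inv_eq_one_div]
    exact one_div_le_one_div_of_le (by norm_num)
      (le_trans hℓ28 (le_self_pow₀ hℓ1 (by norm_num)))
  have hY1 : 1 ≤ Y := by
    rw [hY]; apply Real.one_le_exp
    have h9 : (1:ℝ) ≤ ell D ^ 9 := one_le_pow₀ hℓ1
    linarith
  have hδ0 : 0 < δ := by
    have := Real.add_one_le_exp (2 * (ell D ^ 14)⁻¹); rw [hδ]; linarith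
  have hδ1 : δ ≤ 1 := by
    have h := Real.abs_exp_sub_one_le (x := 2 * (ell D ^ 14)⁻¹)
      (by rw [abs_of_pos (by positivity)]; linarith)
    rw [abs_of_pos (by positivity : (0:ℝ) < 2 * (ell D ^ 14)⁻¹)] at h
    have := le_abs_self (Real.exp (2 * (ell D ^ 14)⁻¹) - 1)
    rw [hδ]; linarith
  have hsupp : ∀ n : ℕ, ‖b126In D χ n‖ ≤ if Y < (n : ℝ) ∧ (n : ℝ) ≤ Y * (1 + δ) then 0.005 else 0 :=
    fun n => norm_b126In_le_window χ hD2 hℓ2 n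
  have hsupp' : ∀ n : ℕ, ‖conj (b126In D χ n)‖ ≤
      if Y < (n : ℝ) ∧ (n : ℝ) ≤ Y * (1 + δ) then 0.005 else 0 := fun n => by
    rw [Complex.norm_conj]; exact hsupp n
  have hS := XiZeroMajorant.norm_Sj_window_le hDS j (by norm_num) (by norm_num) hY1 hY1 hδ0 hδ1
    hδ0 hδ1 hsupp hsupp'
  have hrhs := engine_rhs_inner_le hℓ28
  simp only at hrhs
  have hbound : ‖Sj c' D j (b126In D χ) (fun n : ℕ => conj (b126In D χ n))‖ ≤
      0.005 * 0.005 * XiZeroMajorant.Ew * (321 * (ell D ^ 13)⁻¹) :=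
    le_trans hS (mul_le_mul_of_nonneg_left hrhs (by positivity))
  -- budget: 0.005²·321·Ew·ℓ⁻¹³ ≤ 0.01·Ew·ℓ⁻¹³ ≤ ε(π/ℓ⁹)a₀
  have hineq : 0.01 * XiZeroMajorant.Ew ≤ ε * π * a₀ * ell D ^ 4 := by
    have hM : 0.01 * XiZeroMajorant.Ew / (ε * π * a₀) ≤ ell D := by linarith
    have hM' := (div_le_iff₀ (by positivity : (0 : ℝ) < ε * π * a₀)).mp hM
    have h4 : ell D ≤ ell D ^ 4 := le_self_pow₀ hℓ1 (by norm_num)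
    have hpos : 0 ≤ ε * π * a₀ := by positivity
    nlinarith [mul_le_mul_of_nonneg_left h4 hpos]
  have h13 : ell D ^ 13 = ell D ^ 4 * ell D ^ 9 := by rw [← pow_add]
  calc ‖Sj c' D j (b126In D χ) (fun n : ℕ => conj (b126In D χ n))‖
      ≤ 0.005 * 0.005 * XiZeroMajorant.Ew * (321 * (ell D ^ 13)⁻¹) := hbound
    _ ≤ 0.01 * XiZeroMajorant.Ew * (ell D ^ 13)⁻¹ := by
        have : 0 ≤ XiZeroMajorant.Ew * (ell D ^ 13)⁻¹ := by positivity
        nlinarith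
    _ = 0.01 * XiZeroMajorant.Ew * (ell D ^ 4)⁻¹ * (ell D ^ 9)⁻¹ := by rw [h13, mul_inv]; ring
    _ ≤ (ε * π * a₀ * ell D ^ 4) * (ell D ^ 4)⁻¹ * (ell D ^ 9)⁻¹ := by gcongr
    _ = ε * alpha D * a₀ := by
        rw [mul_inv_cancel_right₀ (pow_ne_zero 4 hℓ0.ne'), hα]; ring
    _ ≤ ε * alpha D * frakA χ := by
        have : 0 ≤ ε * alpha D := by positivity
        exact mul_le_mul_of_nonneg_left ha this

end Core

/-! ### `hS` and (12.6) -/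

/-- **`hS` of (12.6)** — statement LITERALLY the `hS` binder of `Typed.Sec12A.eq126_of_sj_small`:
for every `ε > 0`, eventually under (A), `‖S_j(𝐛,𝐛̄)‖ ≤ ε·α·𝔞` (`j = 1,2,3`) for the coefficient
sequence `𝐛(n) = χ(n)(ϰ₁(n)𝟙[P^{1/2} ≤ n < ⌈P₁⌉] − ϰ₁₂(n)𝟙[P^{0.5}η₋ < n < P₁η₊])` of `H₁₅ − H̃₁₅`.
Core (`Sj_b126In_small`) + pieces (`Sj_h15_window_small_of_inner`, p483242). The manuscript
(§12 p. 67) asserts this with «≪» citing (8.25)/(8.26), which v1 does not contain; here it is an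
absolute-value theorem. [cite: Zhang2022LandauSiegel, §12 (12.6) p.67] -/
theorem Sj_h15_window_small (c' : ℝ) :
    ∀ ε : ℝ, 0 < ε → ForAllLarge fun D _ χ => AssumptionA D χ →
      ∀ j ∈ ({1, 2, 3} : Finset ℕ),
        ‖Sj c' D j
            (fun n : ℕ =>
              (if n ∈ (Finset.Ico 1 ⌈Skeleton.P1 D⌉₊).filter
                    (fun n : ℕ => ¬ (n : ℝ) < bigP D ^ (1 / 2 : ℝ))
                then χ (n : ZMod D) * vk1 D n else 0) -
              (if n ∈ (Finset.Ico 1 ⌈Skeleton.P1 D * etaPM D 1⌉₊).filter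
                    (fun n : ℕ => bigP D ^ (0.5 : ℝ) * etaPM D (-1) < n ∧
                      (n : ℝ) < Skeleton.P1 D * etaPM D 1)
                then χ (n : ZMod D) * vk12 D n else 0))
            (fun n : ℕ => conj (
              (if n ∈ (Finset.Ico 1 ⌈Skeleton.P1 D⌉₊).filter
                    (fun n : ℕ => ¬ (n : ℝ) < bigP D ^ (1 / 2 : ℝ))
                then χ (n : ZMod D) * vk1 D n else 0) -
              (if n ∈ (Finset.Ico 1 ⌈Skeleton.P1 D * etaPM D 1⌉₊).filter
                    (fun n : ℕ => bigP D ^ (0.5 : ℝ) * etaPM D (-1) < n ∧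
                      (n : ℝ) < Skeleton.P1 D * etaPM D 1)
                then χ (n : ZMod D) * vk12 D n else 0)))‖ ≤
          ε * alpha D * frakA χ :=
  Sj_h15_window_small_of_inner c' (Sj_b126In_small c')

/-- **(12.6), pointwise plug** for the skeleton binder `h126 c' hc'` (the four inputs are terms in
scope in `theorem1_of_leaves_v2x`): Prop. 2.2 (i), Lemma 2.3, Lemma 8.1, Prop. 7.1 ⇒ (12.6), via the
tree reduction `eq126_of_sj_small` and `Sj_h15_window_small`. [cite: Zhang2022LandauSiegel, §12 (12.6) p.67] -/
theorem eq126_of_inputs (c' : ℝ) (h22 : Prop22i) (h23 : Lemma23 c') (h81 : Lemma81 c')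
    (h71 : Prop71 c') : Eq126 c' :=
  eq126_of_sj_small c' h22 h23 h81 h71 (Sj_h15_window_small c')

/-- **(12.6) HOLDS for all sufficiently large `c′`** — the leaf-concluding shape of record
(`∃ c₀, 0 ≤ c₀ ∧ ∀ c′ ≥ c₀`, START-HERE §4): from `prop22i_holds`, `lemma23_eventually`,
`lemma81_eventually`, `Section7cStatements.prop71X_holds` and `eq126_of_inputs`. A kernel theorem
about the typed display (12.6) of an unrefereed manuscript; nothing about Landau–Siegel zeros
follows. [cite: Zhang2022LandauSiegel, §12 (12.6) p.67] -/
theorem eq126_holds : ∃ c₀ : ℝ, 0 ≤ c₀ ∧ ∀ c' : ℝ, c₀ ≤ c' → Eq126 c' := by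
  obtain ⟨c₁, hc₁, h23⟩ := lemma23_eventually
  obtain ⟨c₂, -, h81⟩ := lemma81_eventually
  refine ⟨max c₁ c₂, le_trans hc₁ (le_max_left _ _), fun c' hc' => ?_⟩
  exact eq126_of_inputs c' prop22i_holds (h23 c' (le_trans (le_max_left _ _) hc'))
    (h81 c' (le_trans (le_max_right _ _) hc')) (Section7cStatements.prop71X_holds c')

end Literature.NumberTheory.LFunctions.Zhang2022.Typed.Sec12A
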